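import Mathlib
import Summits.PneNP.PneNP.Theorems.Nc03AvoidResidualCoreReductionSolveKit
import Summits.PneNP.PneNP.Theorems.Nc03AvoidResidualCoreReductionEasy

/-!
# Route Nc03AvoidResidualCore, item `ResidualCoreReduction` — the solver, V: classes `4`, `5`

Helper file for `stmt-PneNP-20227` (sequel of `…ReductionSolveA`; cell pnp-ideate). Polynomial
time solvers for the pure classes `4` (`AND₃`) and `5` (`a ∧ (b ∨ c)`) on raw pure instances:
programs `sol4`, `sol5` (searches over `4`- and `5`-tuples of enumerated triples), output length,
correctness on `rawOf J` above the class thresholds (`N < M`, `3N < M`) via `cert4/5_exists` and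
`cert4/5_sound` of `…ReductionEasy`, and `CodeFP` proofs.
-/

set_option linter.dupNamespace false -- `Summit.PneNP.PneNP.…`: summit = sub-problem name (D-0017 single-conjunct layout)

namespace Summit.PneNP.PneNP.Theorems.Nc03Reduction

open Literature.Computability.Complexity CodeFP

variable {N M : ℕ}

/-- `v` is one of the three variables of the enumerated triple `f`. -/
def memb3 (q : ℕ × ETrip) : Bool :=
  decide (q.1 = q.2.2.1) || decide (q.1 = q.2.2.2.1) || decide (q.1 = q.2.2.2.2)

/-- `memb3` is polynomial time. -/
theorem codeFP_memb3 : CodeFP (pairE natE etE) bitE memb3 :=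
  (((codeFP_eqTest (fst _ _) (snd _ _).snd'.fst').or (codeFP_eqTest (fst _ _) (snd _ _).snd'.snd'.fst')).or
    (codeFP_eqTest (fst _ _) (snd _ _).snd'.snd'.snd')).congr fun _ => rfl

/-- Reading `memb3` on genuine triples: membership in `rd3`. -/
theorem memb3_iff (J : LocalMap 3 N M) {p : Fin M} {r : Fin 3} {f : Fin M} :
    memb3 ((J.vars p r).val, (f.val, tripOf J f)) = true ↔ J.vars p r ∈ rd3 J f := by
  simp only [memb3, rd3, Bool.or_eq_true, decide_eq_true_eq, tripOf_fst, tripOf_snd_fst,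
    tripOf_snd_snd, Finset.mem_insert, Finset.mem_singleton, Fin.ext_iff, or_assoc]

/-- `v` is one of the two tail variables (roles `1, 2`) of the enumerated triple `f`. -/
def memb2 (q : ℕ × ETrip) : Bool := decide (q.1 = q.2.2.2.1) || decide (q.1 = q.2.2.2.2)

/-- `memb2` is polynomial time. -/
theorem codeFP_memb2 : CodeFP (pairE natE etE) bitE memb2 :=
  ((codeFP_eqTest (fst _ _) (snd _ _).snd'.snd'.fst').or
    (codeFP_eqTest (fst _ _) (snd _ _).snd'.snd'.snd')).congr fun _ => rfl

/-- Reading `memb2` on genuine triples: membership in `tails`. -/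
theorem memb2_iff (J : LocalMap 3 N M) {p : Fin M} {r : Fin 3} {f : Fin M} :
    memb2 ((J.vars p r).val, (f.val, tripOf J f)) = true ↔ J.vars p r ∈ tails J f := by
  simp only [memb2, tails, Bool.or_eq_true, decide_eq_true_eq, tripOf_snd_fst, tripOf_snd_snd,
    Finset.mem_insert, Finset.mem_singleton, Fin.ext_iff]

/-! ## Class 4: `AND₃` outputs -/

/-- Test, class `4`, on `(e, f₀, f₁, f₂)`: `f_r ≠ e` reads the role-`r` variable of `e`. -/
def test4 (x : ETrip × ETrip × ETrip × ETrip) : Bool :=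
  !decide (x.2.1.1 = x.1.1) && memb3 (x.1.2.1, x.2.1) &&
    (!decide (x.2.2.1.1 = x.1.1) && memb3 (x.1.2.2.1, x.2.2.1)) &&
    (!decide (x.2.2.2.1 = x.1.1) && memb3 (x.1.2.2.2, x.2.2.2))

/-- Solver, class `4`: switch on the three readers, off the read output. -/
def sol4 (pr : PRaw) : List Bool :=
  searchOut pr.2.1 ((((enumT pr).product ((enumT pr).product ((enumT pr).product (enumT pr)))).find?
    test4).map fun x => [x.2.1.1, x.2.2.1.1, x.2.2.2.1])

/-- Output length, class `4`. -/
@[simp] theorem length_sol4 (pr : PRaw) : (sol4 pr).length = pr.2.1 := by unfold sol4; simp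

/-- Correctness, class `4`. -/
theorem sol4_correct (J : LocalMap 3 N M) (hP : J.IsPure (rep 4)) (hM : N < M) :
    (fun p : Fin M => (sol4 (rawOf J)).getD p.val false) ∉ J.range := by
  obtain ⟨e, f, hf⟩ := cert4_exists J hM
  set cands := (enumT (rawOf J)).product ((enumT (rawOf J)).product
    ((enumT (rawOf J)).product (enumT (rawOf J)))) with hc
  set x₀ : ETrip × ETrip × ETrip × ETrip :=
    ((e.val, tripOf J e), (((f 0).val, tripOf J (f 0)), (((f 1).val, tripOf J (f 1)),
      ((f 2).val, tripOf J (f 2))))) with hx₀def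
  have hne : ∀ r, (f r).val ≠ e.val := fun r h => (hf r).1 (Fin.ext h)
  have hx₀ : test4 x₀ = true := by
    simp only [test4, hx₀def, Bool.and_eq_true, Bool.not_eq_true', decide_eq_false_iff_not]
    refine ⟨⟨⟨hne 0, ?_⟩, hne 1, ?_⟩, hne 2, ?_⟩
    · exact (memb3_iff J).2 (hf 0).2
    · exact (memb3_iff J).2 (hf 1).2
    · exact (memb3_iff J).2 (hf 2).2
  have hmem : x₀ ∈ cands :=
    List.pair_mem_product.2 ⟨mem_enumT J e, List.pair_mem_product.2 ⟨mem_enumT J (f 0),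
      List.pair_mem_product.2 ⟨mem_enumT J (f 1), mem_enumT J (f 2)⟩⟩⟩
  cases h : cands.find? test4 with
  | none => exact absurd hx₀ (by have := List.find?_eq_none.1 h _ hmem; simpa using this)
  | some x =>
    obtain ⟨xe, x0, x1, x2⟩ := x
    have hx := List.find?_some h
    have hm := List.mem_of_find?_eq_some h
    obtain ⟨h1, hm1⟩ := List.pair_mem_product.1 hm
    obtain ⟨h2, hm2⟩ := List.pair_mem_product.1 hm1
    obtain ⟨h3, h4⟩ := List.pair_mem_product.1 hm2
    obtain ⟨pe, rfl⟩ := (mem_enumT_iff J).1 h1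
    obtain ⟨p0, rfl⟩ := (mem_enumT_iff J).1 h2
    obtain ⟨p1, rfl⟩ := (mem_enumT_iff J).1 h3
    obtain ⟨p2, rfl⟩ := (mem_enumT_iff J).1 h4
    simp only [test4, Bool.and_eq_true, Bool.not_eq_true', decide_eq_false_iff_not] at hx
    obtain ⟨⟨⟨hn0, hm0⟩, hn1, hm1'⟩, hn2, hm2'⟩ := hx
    rw [tripOf_fst, memb3_iff] at hm0
    rw [tripOf_snd_fst, memb3_iff] at hm1'
    rw [tripOf_snd_snd, memb3_iff] at hm2'
    have hsol : sol4 (rawOf J) = indic M [p0.val, p1.val, p2.val] := by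
      unfold sol4; rw [← hc, h]; rfl
    refine cert4_sound hP (e := pe) (f := ![p0, p1, p2]) (fun r => ?_) (fun r => ?_) ?_
    · fin_cases r
      · exact hm0
      · exact hm1'
      · exact hm2'
    · show (sol4 (rawOf J)).getD (![p0, p1, p2] r).val false = true
      rw [hsol, indic_at]
      fin_cases r <;> simp
    · show (sol4 (rawOf J)).getD pe.val false = false
      rw [hsol, indic_at]
      simp only [List.mem_cons, List.not_mem_nil, or_false, decide_eq_false_iff_not, not_or]
      exact ⟨fun h => hn0 h.symm, fun h => hn1 h.symm, fun h => hn2 h.symm⟩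

/-- Polynomial time, class `4`. -/
theorem codeFP_sol4 : CodeFP prE (rawE bitE) sol4 := by
  have hc : CodeFP prE (rawE (pairE etE (pairE etE (pairE etE etE))))
      (fun pr => (enumT pr).product ((enumT pr).product ((enumT pr).product (enumT pr)))) :=
    (rawProduct _ _).comp (codeFP_enumT.pair ((rawProduct _ _).comp (codeFP_enumT.pair
      ((rawProduct _ _).comp (codeFP_enumT.pair codeFP_enumT)))))
  have pe : CodeFP (pairE etE (pairE etE (pairE etE etE))) etE (fun x => x.1) := fst _ _
  have p0 : CodeFP (pairE etE (pairE etE (pairE etE etE))) etE (fun x => x.2.1) := (snd _ _).fst'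
  have p1 : CodeFP (pairE etE (pairE etE (pairE etE etE))) etE (fun x => x.2.2.1) := (snd _ _).snd'.fst'
  have p2 : CodeFP (pairE etE (pairE etE (pairE etE etE))) etE (fun x => x.2.2.2) := (snd _ _).snd'.snd'
  have ht : CodeFP (pairE etE (pairE etE (pairE etE etE))) bitE test4 :=
    ((((codeFP_eqTest p0.fst' pe.fst').not.and (codeFP_memb3.comp (pe.snd'.fst'.pair p0))).and
      ((codeFP_eqTest p1.fst' pe.fst').not.and (codeFP_memb3.comp (pe.snd'.snd'.fst'.pair p1)))).and
      ((codeFP_eqTest p2.fst' pe.fst').not.and (codeFP_memb3.comp (pe.snd'.snd'.snd'.pair p2)))).congr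
      fun _ => rfl
  have hr : CodeFP (pairE etE (pairE etE (pairE etE etE))) (rawE natE)
      (fun x => [x.2.1.1, x.2.2.1.1, x.2.2.2.1]) :=
    ((rawCons natE).comp (p0.fst'.pair ((rawCons natE).comp (p1.fst'.pair
      ((rawSingleton natE).comp p2.fst'))))).congr fun _ => rfl
  exact (codeFP_searchOut hc ht hr).congr fun pr => by unfold sol4; rfl

/-! ## Class 5: `a ∧ (b ∨ c)` outputs -/

/-- Test, class `5`, on `(j, k, k₁, l, l₁)` (see `cert5_sound`). -/
def test5 (x : ETrip × ETrip × ETrip × ETrip × ETrip) : Bool :=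
  !decide (x.2.1.1 = x.1.1) && !decide (x.2.2.2.1.1 = x.1.1) &&
    (!decide (x.2.2.1.1 = x.2.1.1) && !decide (x.2.2.1.1 = x.2.2.2.1.1)) &&
    (!decide (x.2.2.2.2.1 = x.2.1.1) && !decide (x.2.2.2.2.1 = x.2.2.2.1.1)) &&
    (memb2 (x.1.2.2.2, x.2.1) && decide (x.2.2.1.2.1 = x.2.1.2.1)) &&
    (memb2 (x.1.2.2.1, x.2.2.2.1) && decide (x.2.2.2.2.2.1 = x.2.2.2.1.2.1))

/-- Solver, class `5`: switch on `j, k₁, l₁`, off the rest. -/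
def sol5 (pr : PRaw) : List Bool :=
  searchOut pr.2.1 ((((enumT pr).product ((enumT pr).product ((enumT pr).product
    ((enumT pr).product (enumT pr))))).find? test5).map fun x => [x.1.1, x.2.2.1.1, x.2.2.2.2.1])

/-- Output length, class `5`. -/
@[simp] theorem length_sol5 (pr : PRaw) : (sol5 pr).length = pr.2.1 := by unfold sol5; simp

/-- Correctness, class `5`. -/
theorem sol5_correct (J : LocalMap 3 N M) (hP : J.IsPure (rep 5)) (hM : 3 * N < M) :
    (fun p : Fin M => (sol5 (rawOf J)).getD p.val false) ∉ J.range := by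
  obtain ⟨j, k, k₁, l, l₁, hkj, hlj, hk₁k, hk₁l, hl₁k, hl₁l, hjk, hk₁, hjl, hl₁⟩ := cert5_exists J hM
  set cands := (enumT (rawOf J)).product ((enumT (rawOf J)).product ((enumT (rawOf J)).product
    ((enumT (rawOf J)).product (enumT (rawOf J))))) with hc
  set x₀ : ETrip × ETrip × ETrip × ETrip × ETrip :=
    ((j.val, tripOf J j), ((k.val, tripOf J k), ((k₁.val, tripOf J k₁), ((l.val, tripOf J l),
      (l₁.val, tripOf J l₁))))) with hx₀def
  have vne : ∀ {a b : Fin M}, a ≠ b → a.val ≠ b.val := fun h e => h (Fin.ext e)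
  have hx₀ : test5 x₀ = true := by
    simp only [test5, hx₀def, Bool.and_eq_true, Bool.not_eq_true', decide_eq_false_iff_not,
      decide_eq_true_eq, tripOf_fst]
    refine ⟨⟨⟨⟨⟨vne hkj, vne hlj⟩, vne hk₁k, vne hk₁l⟩, vne hl₁k, vne hl₁l⟩, ?_, congrArg Fin.val hk₁⟩,
      ?_, congrArg Fin.val hl₁⟩
    · rw [tripOf_snd_snd]; exact (memb2_iff J).2 hjk
    · rw [tripOf_snd_fst]; exact (memb2_iff J).2 hjl
  have hmem : x₀ ∈ cands :=
    List.pair_mem_product.2 ⟨mem_enumT J j, List.pair_mem_product.2 ⟨mem_enumT J k,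
      List.pair_mem_product.2 ⟨mem_enumT J k₁, List.pair_mem_product.2 ⟨mem_enumT J l, mem_enumT J l₁⟩⟩⟩⟩
  cases h : cands.find? test5 with
  | none => exact absurd hx₀ (by have := List.find?_eq_none.1 h _ hmem; simpa using this)
  | some x =>
    obtain ⟨xj, xk, xk1, xl, xl1⟩ := x
    have hx := List.find?_some h
    have hm := List.mem_of_find?_eq_some h
    obtain ⟨h1, hm1⟩ := List.pair_mem_product.1 hm
    obtain ⟨h2, hm2⟩ := List.pair_mem_product.1 hm1
    obtain ⟨h3, hm3⟩ := List.pair_mem_product.1 hm2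
    obtain ⟨h4, h5⟩ := List.pair_mem_product.1 hm3
    obtain ⟨pj, rfl⟩ := (mem_enumT_iff J).1 h1
    obtain ⟨pk, rfl⟩ := (mem_enumT_iff J).1 h2
    obtain ⟨pk1, rfl⟩ := (mem_enumT_iff J).1 h3
    obtain ⟨pl, rfl⟩ := (mem_enumT_iff J).1 h4
    obtain ⟨pl1, rfl⟩ := (mem_enumT_iff J).1 h5
    simp only [test5, Bool.and_eq_true, Bool.not_eq_true', decide_eq_false_iff_not, decide_eq_true_eq,
      tripOf_fst] at hx
    obtain ⟨⟨⟨⟨⟨nkj, nlj⟩, nk1k, nk1l⟩, nl1k, nl1l⟩, mjk, ek1⟩, mjl, el1⟩ := hx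
    rw [tripOf_snd_snd, memb2_iff] at mjk
    rw [tripOf_snd_fst, memb2_iff] at mjl
    have hsol : sol5 (rawOf J) = indic M [pj.val, pk1.val, pl1.val] := by
      unfold sol5; rw [← hc, h]; rfl
    refine cert5_sound hP mjk (vars_eq_of_val_eq J ek1) mjl (vars_eq_of_val_eq J el1) ?_ ?_ ?_ ?_ ?_
    · show (sol5 (rawOf J)).getD pj.val false = true
      rw [hsol, indic_at]; simp
    · show (sol5 (rawOf J)).getD pk1.val false = true
      rw [hsol, indic_at]; simp
    · show (sol5 (rawOf J)).getD pl1.val false = true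
      rw [hsol, indic_at]; simp
    · show (sol5 (rawOf J)).getD pk.val false = false
      rw [hsol, indic_at]
      simp only [List.mem_cons, List.not_mem_nil, or_false, decide_eq_false_iff_not, not_or]
      exact ⟨nkj, fun e => nk1k e.symm, fun e => nl1k e.symm⟩
    · show (sol5 (rawOf J)).getD pl.val false = false
      rw [hsol, indic_at]
      simp only [List.mem_cons, List.not_mem_nil, or_false, decide_eq_false_iff_not, not_or]
      exact ⟨nlj, fun e => nk1l e.symm, fun e => nl1l e.symm⟩

/-- Polynomial time, class `5`. -/
theorem codeFP_sol5 : CodeFP prE (rawE bitE) sol5 := by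
  have hc : CodeFP prE (rawE (pairE etE (pairE etE (pairE etE (pairE etE etE)))))
      (fun pr => (enumT pr).product ((enumT pr).product ((enumT pr).product
        ((enumT pr).product (enumT pr))))) :=
    (rawProduct _ _).comp (codeFP_enumT.pair ((rawProduct _ _).comp (codeFP_enumT.pair
      ((rawProduct _ _).comp (codeFP_enumT.pair ((rawProduct _ _).comp
        (codeFP_enumT.pair codeFP_enumT)))))))
  have pj : CodeFP (pairE etE (pairE etE (pairE etE (pairE etE etE)))) etE (fun x => x.1) := fst _ _
  have pk : CodeFP (pairE etE (pairE etE (pairE etE (pairE etE etE)))) etE (fun x => x.2.1) :=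
    (snd _ _).fst'
  have pk1 : CodeFP (pairE etE (pairE etE (pairE etE (pairE etE etE)))) etE (fun x => x.2.2.1) :=
    (snd _ _).snd'.fst'
  have pl : CodeFP (pairE etE (pairE etE (pairE etE (pairE etE etE)))) etE (fun x => x.2.2.2.1) :=
    (snd _ _).snd'.snd'.fst'
  have pl1 : CodeFP (pairE etE (pairE etE (pairE etE (pairE etE etE)))) etE (fun x => x.2.2.2.2) :=
    (snd _ _).snd'.snd'.snd'
  have ht : CodeFP (pairE etE (pairE etE (pairE etE (pairE etE etE)))) bitE test5 :=
    ((((((codeFP_eqTest pk.fst' pj.fst').not.and (codeFP_eqTest pl.fst' pj.fst').not).and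
      ((codeFP_eqTest pk1.fst' pk.fst').not.and (codeFP_eqTest pk1.fst' pl.fst').not)).and
      ((codeFP_eqTest pl1.fst' pk.fst').not.and (codeFP_eqTest pl1.fst' pl.fst').not)).and
      ((codeFP_memb2.comp (pj.snd'.snd'.snd'.pair pk)).and (codeFP_eqTest pk1.snd'.fst' pk.snd'.fst'))).and
      ((codeFP_memb2.comp (pj.snd'.snd'.fst'.pair pl)).and
        (codeFP_eqTest pl1.snd'.fst' pl.snd'.fst'))).congr fun _ => rfl
  have hr : CodeFP (pairE etE (pairE etE (pairE etE (pairE etE etE)))) (rawE natE)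
      (fun x => [x.1.1, x.2.2.1.1, x.2.2.2.2.1]) :=
    ((rawCons natE).comp (pj.fst'.pair ((rawCons natE).comp (pk1.fst'.pair
      ((rawSingleton natE).comp pl1.fst'))))).congr fun _ => rfl
  exact (codeFP_searchOut hc ht hr).congr fun pr => by unfold sol5; rfl

end Summit.PneNP.PneNP.Theorems.Nc03Reduction
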